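import Literature.Probability.LatticeModels.FieldScalingLimit
import HarnessLib

/-!
# The joint law of the rescaled critical Ising spin and energy fields

Topic `Literature/Probability/LatticeModels`; notion `isingSpinEnergyFieldLaw` (definition request of
route `GammaForcesInteraction`, item `stmt-CriticalPhenomena-4748`, sub-problem
`CriticalPhenomena/Ising3DConformalLimit`). Extends `isingFieldLaw` of
`Literature/Probability/LatticeModels/FieldScalingLimit.lean` (the law of the rescaled SPIN field
alone) by the rescaled, centred nearest-neighbour ENERGY field.

For a spin configuration `σ : ℤᵈ → {±1}`, a finite volume `Λ ⊆ ℤᵈ`, a mesh `δ` and renormalisations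
`ρ` (spin) and `Z` (energy):

* `Φ_δ(f) = ρ δᵈ ∑_{x ∈ Λ} f(δx) σₓ` is the smeared spin field `spinField Λ δ ρ σ`
  (`LatticeScalarField.lean`);
* `energyDensity a σ = ∑_{i : Fin d} σ_a σ_{a+eᵢ}` is the nearest-neighbour energy density at the
  site `a` (the `d` forward bonds out of `a`, so that every nearest-neighbour edge of `ℤᵈ` is counted
  exactly once), `centredEnergyDensity μ a σ = ∑ᵢ (σ_a σ_{a+eᵢ} − ⟨σ_a σ_{a+eᵢ}⟩_μ)` its centring
  by the bond expectations of a law `μ`;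
* `energyField μ Λ δ Z σ = ∑_{a ∈ Λ} (Z δᵈ · centredEnergyDensity μ a σ) • δ_{δa}`, i.e.
  `E_δ(h) = Z δᵈ ∑_{a ∈ Λ} ∑ᵢ h(δa) (σ_a σ_{a+eᵢ} − ⟨σ_a σ_{a+eᵢ}⟩_μ)` (`energyField_apply`), a
  tempered distribution on `ℝᵈ = EuclideanSpace ℝ (Fin d)`;
* `spinEnergyFieldLaw μ Λ δ ρ Z` is the joint law of `σ ↦ (Φ_δ, E_δ)` under `μ`, a measure on
  `FieldConfig ℝᵈ × FieldConfig ℝᵈ` (product σ-algebra of the Borel σ-algebras);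
* `isingSpinEnergyFieldLaw d β L δ ρ Z` is the case `μ = μ⁺_{box d (L δ); β, 0}` (finite-volume plus
  measure `isingMeasure (zdGraph d) (box d (L δ)) β 0 .plus`), `Λ = box d (L δ)`, `ρ = ρ(δ)`,
  `Z = Z(δ)`; consumers take `β = β_c(d)` and impose `δ L(δ) → ∞` exactly as for `isingFieldLaw`.

API: unfolding lemmas, measurability, the `IsProbabilityMeasure` instances, the marginals
(`isingSpinEnergyFieldLaw_fst = isingFieldLaw`, `…_snd`) and the centring
`∫ ω.2 h d(isingSpinEnergyFieldLaw …) = 0` (`integral_snd_apply_isingSpinEnergyFieldLaw`).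

## Sources

* M. Aizenman, H. Duminil-Copin, *Marginal triviality of the scaling limits of critical 4D Ising and
  `φ⁴₄` models*, Ann. Math. 194 (2021), §1.2, eq. (1.5): the smeared lattice field `T_{f,L}`.
* C. Hongler, S. Smirnov, *The energy density in the planar Ising model*, Acta Math. 211 (2013)
  191–225, §1 'The energy density' (§1.4 of arXiv:1008.2645): the energy density of an edge
  `⟨e, w⟩` is the product of adjacent spins `σ_e σ_w` centred by a constant (there the
  infinite-volume critical value `√2/2` of `ℤ²`); "the energy density field is the fluctuation of
  the product of adjacent spins around this limit".
* S. Friedli, Y. Velenik, *Statistical Mechanics of Lattice Systems* (2017), §3.1 (finite-volume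
  Gibbs measures with `+` boundary condition, nearest-neighbour Hamiltonian `∑_{xy} σ_x σ_y`).

## Design

* **Centring.** The request asks for the centred energy density `σ_a σ_{a+eᵢ} − ⟨σ_a σ_{a+eᵢ}⟩`. We
  centre by the bond expectation under the SAME law `μ` that `σ` is sampled from (for
  `isingSpinEnergyFieldLaw`: the finite-volume plus measure in the box), so that `E_δ(h)` is a
  genuinely centred random variable (`integral_energyField_apply`). Centring instead by a constant
  (Hongler–Smirnov subtract the infinite-volume critical value) changes `E_δ` by a deterministic
  tempered distribution only; covariances `⟨Φ_δ Φ_δ ; E_δ⟩` and measurability of `E_δ` with respect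
  to `Φ_δ` (the uses foreseen by the requesting route) are insensitive to this choice.
* **Forward bonds.** `∑_{i : Fin d} σ_a σ_{a + eᵢ}` (`eᵢ = Pi.single i 1`, the convention of
  `zdGraph_adj_iff` and of the requesting route's lattice sums) attaches each edge `{a, a + eᵢ}` of
  `ℤᵈ` to its lower endpoint; bonds leaving `Λ` are included (under the plus measure the outside
  spin is `+1`). For `d = 0` the sum is empty and the energy field vanishes (no junk).
* **Reuse.** `energyField` is `finLatticeField Λ δ Z` (the generic smearing map of
  `LatticeScalarField.lean`) applied to the site field `a ↦ centredEnergyDensity μ a σ`, so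
  measurability and the evaluation formula are inherited; the joint law is `Measure.map` of the
  pair map, its marginals are Mathlib's `Measure.fst`/`Measure.snd`.
* Not here: the infinite-volume (`plusExpect`) smearing, scaling limits of `E_δ`, the choice of
  `Z(δ)`; those belong to the consumers.
-/

noncomputable section

open scoped SchwartzMap
open MeasureTheory Filter Finset

namespace Literature.Probability.LatticeModels

open Literature.MathematicalPhysics.QuantumLattice

variable {d : ℕ}

/-! ### The nearest-neighbour energy density -/

/-- The nearest-neighbour **energy density** at the site `a ∈ ℤᵈ` of a spin configuration `σ`:
`energyDensity a σ = ∑_{i : Fin d} σ_a σ_{a + eᵢ}`, the sum of the bond observables `σ_a σ_b` over the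
`d` forward bonds `b = a + eᵢ` out of `a` (each nearest-neighbour edge of `ℤᵈ` counted once, at its
lower endpoint). (Hongler–Smirnov 2013, §1 'The energy density', the product of adjacent spins
`σ_e σ_w` of an edge; Friedli–Velenik 2017, §3.1, the nearest-neighbour Hamiltonian density.) [cite: HonglerSmirnov2013, §1 'The energy density' (arXiv:1008.2645 §1.4)] -/
def energyDensity (a : Site d) (σ : SpinConfig (Site d)) : ℝ :=
  ∑ i : Fin d, spinPair a (a + Pi.single i 1) σ

/-- `energyDensity a σ = ∑ᵢ σ_a σ_{a+eᵢ}`. (Friedli–Velenik 2017, §3.1.) [cite: FriedliVelenik2017, §3.1] -/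
theorem energyDensity_eq (a : Site d) (σ : SpinConfig (Site d)) :
    energyDensity a σ = ∑ i : Fin d, spinAt a σ * spinAt (a + Pi.single i 1) σ := rfl

/-- The energy density is a measurable observable (finite sum of bond observables;
Friedli–Velenik 2017, §6.2). [cite: FriedliVelenik2017, §6.2] -/
@[fun_prop]
theorem measurable_energyDensity (a : Site d) : Measurable (energyDensity (d := d) a) := by
  unfold energyDensity
  exact Finset.measurable_sum _ fun i _ => measurable_spinPair _ _

/-- `|energyDensity a σ| ≤ d`: each of the `d` bond observables is `±1`.
(Friedli–Velenik 2017, §3.1.) [cite: FriedliVelenik2017, §3.1] -/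
theorem abs_energyDensity_le (a : Site d) (σ : SpinConfig (Site d)) : |energyDensity a σ| ≤ d := by
  unfold energyDensity
  calc |∑ i : Fin d, spinPair a (a + Pi.single i 1) σ|
      ≤ ∑ i : Fin d, |spinPair a (a + Pi.single i 1) σ| := Finset.abs_sum_le_sum_abs _ _
    _ = ∑ _i : Fin d, (1 : ℝ) := Finset.sum_congr rfl fun i _ => by simp [spinPair, abs_mul]
    _ = d := by simp

/-- The **centred energy density** at `a` with respect to a law `μ` on spin configurations:
`∑_{i : Fin d} (σ_a σ_{a+eᵢ} − ⟨σ_a σ_{a+eᵢ}⟩_μ)`, i.e. `energyDensity a σ` minus the sum of the bond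
expectations `spinTwoPoint μ a (a + eᵢ)`. Under a probability measure `μ` it has mean zero
(`integral_centredEnergyDensity`). (Hongler–Smirnov 2013, §1 'The energy density': "the energy
density field is the fluctuation of the product of adjacent spins" around its expectation — there
the infinite-volume critical constant `√2/2` of `ℤ²`; here the centring is by `μ` itself, see the
module docstring.) [cite: HonglerSmirnov2013, §1 'The energy density' (arXiv:1008.2645 §1.4)] -/
def centredEnergyDensity (μ : Measure (SpinConfig (Site d))) (a : Site d)
    (σ : SpinConfig (Site d)) : ℝ :=
  ∑ i : Fin d, (spinPair a (a + Pi.single i 1) σ - spinTwoPoint μ a (a + Pi.single i 1))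

/-- `centredEnergyDensity μ a σ = energyDensity a σ − ∑ᵢ ⟨σ_a σ_{a+eᵢ}⟩_μ`. [folklore] -/
theorem centredEnergyDensity_eq (μ : Measure (SpinConfig (Site d))) (a : Site d)
    (σ : SpinConfig (Site d)) :
    centredEnergyDensity μ a σ =
      energyDensity a σ - ∑ i : Fin d, spinTwoPoint μ a (a + Pi.single i 1) := by
  simp [centredEnergyDensity, energyDensity, Finset.sum_sub_distrib]

/-- The centred energy density is measurable in `σ`. (Friedli–Velenik 2017, §6.2.) [cite: FriedliVelenik2017, §6.2] -/
@[fun_prop]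
theorem measurable_centredEnergyDensity (μ : Measure (SpinConfig (Site d))) (a : Site d) :
    Measurable (centredEnergyDensity μ a) := by
  unfold centredEnergyDensity
  exact Finset.measurable_sum _ fun i _ => (measurable_spinPair _ _).sub measurable_const

/-- Bond observables are bounded by `1`, hence integrable under a finite measure. [folklore] -/
private theorem integrable_spinPair_aux (μ : Measure (SpinConfig (Site d))) [IsFiniteMeasure μ]
    (x y : Site d) : Integrable (spinPair x y) μ :=
  Integrable.of_bound (measurable_spinPair x y).aestronglyMeasurable 1
    (Filter.Eventually.of_forall fun s => by simp [Real.norm_eq_abs, spinPair])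

/-- The centred energy density is integrable under a finite measure (it is bounded). [folklore] -/
theorem integrable_centredEnergyDensity (μ : Measure (SpinConfig (Site d))) [IsFiniteMeasure μ]
    (a : Site d) : Integrable (centredEnergyDensity μ a) μ := by
  unfold centredEnergyDensity
  exact integrable_finsetSum _ fun i _ =>
    (integrable_spinPair_aux μ _ _).sub (integrable_const _)

/-- **Centring.** Under a probability measure `μ` the centred energy density has mean zero:
`∫ ∑ᵢ (σ_a σ_{a+eᵢ} − ⟨σ_a σ_{a+eᵢ}⟩_μ) dμ(σ) = 0`. [folklore] -/
theorem integral_centredEnergyDensity (μ : Measure (SpinConfig (Site d))) [IsProbabilityMeasure μ]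
    (a : Site d) : ∫ σ, centredEnergyDensity μ a σ ∂μ = 0 := by
  unfold centredEnergyDensity
  have hint : ∀ i ∈ (univ : Finset (Fin d)), Integrable (fun σ : SpinConfig (Site d) =>
      spinPair a (a + Pi.single i 1) σ - spinTwoPoint μ a (a + Pi.single i 1)) μ :=
    fun i _ => (integrable_spinPair_aux μ _ _).sub (integrable_const _)
  rw [integral_finsetSum _ hint]
  refine Finset.sum_eq_zero fun i _ => ?_
  rw [integral_sub (integrable_spinPair_aux μ _ _) (integrable_const _), integral_const]
  simp [spinTwoPoint]

/-! ### The rescaled energy field -/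

/-- The **rescaled, centred energy field** of a spin configuration `σ` over the finite volume `Λ`, at
mesh `δ` with energy renormalisation `Z`, as a tempered distribution on `ℝᵈ`:
`energyField μ Λ δ Z σ = ∑_{a ∈ Λ} (Z δᵈ · centredEnergyDensity μ a σ) • δ_{δa}`, i.e.
`E_δ(h) = Z δᵈ ∑_{a ∈ Λ} ∑_{i : Fin d} h(δa) (σ_a σ_{a+eᵢ} − ⟨σ_a σ_{a+eᵢ}⟩_μ)` (`energyField_apply`).
This is the smearing `finLatticeField Λ δ Z` (Aizenman–Duminil-Copin 2021, (1.5), `T_{f,L}`) of the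
site field `a ↦ centredEnergyDensity μ a σ` (Hongler–Smirnov 2013, §1 'The energy density', the energy density as a
lattice field). [cite: AizenmanDuminilCopinAnnals2021, §1.2 eq. (1.5)] -/
def energyField (μ : Measure (SpinConfig (Site d))) (Λ : Finset (Site d)) (δ Z : ℝ)
    (σ : SpinConfig (Site d)) : FieldConfig (EuclideanSpace ℝ (Fin d)) :=
  finLatticeField Λ δ Z fun a => centredEnergyDensity μ a σ

/-- Unfolding lemma: `energyField` is `finLatticeField` of the centred energy density.
[cite: AizenmanDuminilCopinAnnals2021, §1.2 eq. (1.5)] -/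
theorem energyField_eq_finLatticeField (μ : Measure (SpinConfig (Site d))) (Λ : Finset (Site d))
    (δ Z : ℝ) (σ : SpinConfig (Site d)) :
    energyField μ Λ δ Z σ = finLatticeField Λ δ Z (fun a => centredEnergyDensity μ a σ) := rfl

/-- **Evaluation formula** (the printed form of the request):
`E_δ(h) = Z δᵈ ∑_{a ∈ Λ} ∑_{i : Fin d} h(δa) (σ_a σ_{a+eᵢ} − ⟨σ_a σ_{a+eᵢ}⟩_μ)`.
(Aizenman–Duminil-Copin 2021, (1.5); Hongler–Smirnov 2013, §1.) [cite: AizenmanDuminilCopinAnnals2021, §1.2 eq. (1.5)] -/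
theorem energyField_apply (μ : Measure (SpinConfig (Site d))) (Λ : Finset (Site d)) (δ Z : ℝ)
    (σ : SpinConfig (Site d)) (h : 𝓢(EuclideanSpace ℝ (Fin d), ℝ)) :
    energyField μ Λ δ Z σ h =
      Z * δ ^ d * ∑ a ∈ Λ, ∑ i : Fin d, h (δ • siteToE a) *
        (spinAt a σ * spinAt (a + Pi.single i 1) σ - spinTwoPoint μ a (a + Pi.single i 1)) := by
  rw [energyField, finLatticeField_apply, Finset.mul_sum]
  refine Finset.sum_congr rfl fun a _ => ?_
  rw [centredEnergyDensity, Finset.mul_sum, Finset.sum_mul, Finset.mul_sum]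
  refine Finset.sum_congr rfl fun i _ => ?_
  simp only [spinPair]
  ring

/-- The energy smearing map `σ ↦ E_δ` is measurable (product σ-algebra on `ℤᵈ → ℤˣ` to the Borel
σ-algebra of `FieldConfig ℝᵈ`). (Glimm–Jaffe 1987, §6.1, §9.5, via `measurable_finLatticeField`.) [cite: GlimmJaffe1987, §6.1  §9.5] -/
@[fun_prop]
theorem measurable_energyField (μ : Measure (SpinConfig (Site d))) (Λ : Finset (Site d))
    (δ Z : ℝ) : Measurable (energyField μ Λ δ Z) :=
  (measurable_finLatticeField Λ δ Z).comp
    (measurable_pi_lambda _ fun a => measurable_centredEnergyDensity μ a)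

/-- **Centring of the energy field.** Under a probability measure `μ`, `∫ E_δ(h) dμ = 0` for every
test function `h`. [folklore] -/
theorem integral_energyField_apply (μ : Measure (SpinConfig (Site d))) [IsProbabilityMeasure μ]
    (Λ : Finset (Site d)) (δ Z : ℝ) (h : 𝓢(EuclideanSpace ℝ (Fin d), ℝ)) :
    ∫ σ, energyField μ Λ δ Z σ h ∂μ = 0 := by
  simp only [energyField_eq_finLatticeField, finLatticeField_apply]
  have hint : ∀ a ∈ Λ, Integrable (fun σ : SpinConfig (Site d) =>
      Z * δ ^ d * centredEnergyDensity μ a σ * h (δ • siteToE a)) μ :=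
    fun a _ => ((integrable_centredEnergyDensity μ a).const_mul (Z * δ ^ d)).mul_const _
  rw [integral_finsetSum _ hint]
  refine Finset.sum_eq_zero fun a _ => ?_
  rw [integral_mul_const, integral_const_mul, integral_centredEnergyDensity, mul_zero, zero_mul]

/-! ### The joint spin–energy field and its law -/

/-- The joint smearing map `σ ↦ (Φ_δ, E_δ)`: the rescaled spin field `spinField Λ δ ρ σ`
(`Φ_δ(f) = ρ δᵈ ∑_{x ∈ Λ} f(δx) σₓ`) paired with the rescaled centred energy field
`energyField μ Λ δ Z σ`. (Aizenman–Duminil-Copin 2021, (1.5); Hongler–Smirnov 2013, §1.) [cite: AizenmanDuminilCopinAnnals2021, §1.2 eq. (1.5)] -/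
def spinEnergyField (μ : Measure (SpinConfig (Site d))) (Λ : Finset (Site d)) (δ ρ Z : ℝ)
    (σ : SpinConfig (Site d)) :
    FieldConfig (EuclideanSpace ℝ (Fin d)) × FieldConfig (EuclideanSpace ℝ (Fin d)) :=
  (spinField Λ δ ρ σ, energyField μ Λ δ Z σ)

/-- First component of the joint field: the spin field. [folklore] -/
@[simp]
theorem spinEnergyField_fst (μ : Measure (SpinConfig (Site d))) (Λ : Finset (Site d))
    (δ ρ Z : ℝ) (σ : SpinConfig (Site d)) :
    (spinEnergyField μ Λ δ ρ Z σ).1 = spinField Λ δ ρ σ := rfl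

/-- Second component of the joint field: the energy field. [folklore] -/
@[simp]
theorem spinEnergyField_snd (μ : Measure (SpinConfig (Site d))) (Λ : Finset (Site d))
    (δ ρ Z : ℝ) (σ : SpinConfig (Site d)) :
    (spinEnergyField μ Λ δ ρ Z σ).2 = energyField μ Λ δ Z σ := rfl

/-- The joint smearing map is measurable into the product σ-algebra. (Glimm–Jaffe 1987, §6.1.) [cite: GlimmJaffe1987, §6.1] -/
@[fun_prop]
theorem measurable_spinEnergyField (μ : Measure (SpinConfig (Site d))) (Λ : Finset (Site d))
    (δ ρ Z : ℝ) : Measurable (spinEnergyField μ Λ δ ρ Z) :=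
  (measurable_spinField Λ δ ρ).prodMk (measurable_energyField μ Λ δ Z)

/-- The **joint law of the rescaled spin and energy fields** under a law `μ` on spin configurations
of `ℤᵈ`: the push-forward of `μ` along `σ ↦ (Φ_δ, E_δ) = spinEnergyField μ Λ δ ρ Z σ`, a measure on
`FieldConfig ℝᵈ × FieldConfig ℝᵈ`. Its first marginal is `spinFieldLaw μ Λ δ ρ`
(`spinEnergyFieldLaw_fst`). (Aizenman–Duminil-Copin 2021, §1.2; Hongler–Smirnov 2013, §1.) [cite: AizenmanDuminilCopinAnnals2021, §1.2] -/
def spinEnergyFieldLaw (μ : Measure (SpinConfig (Site d))) (Λ : Finset (Site d)) (δ ρ Z : ℝ) :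
    Measure (FieldConfig (EuclideanSpace ℝ (Fin d)) × FieldConfig (EuclideanSpace ℝ (Fin d))) :=
  μ.map (spinEnergyField μ Λ δ ρ Z)

/-- Push-forward laws of probability measures are probability measures
(`Measure.isProbabilityMeasure_map`). [folklore] -/
instance spinEnergyFieldLaw.instIsProbabilityMeasure (μ : Measure (SpinConfig (Site d)))
    [IsProbabilityMeasure μ] (Λ : Finset (Site d)) (δ ρ Z : ℝ) :
    IsProbabilityMeasure (spinEnergyFieldLaw μ Λ δ ρ Z) :=
  Measure.isProbabilityMeasure_map (measurable_spinEnergyField μ Λ δ ρ Z).aemeasurable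

/-- The spin marginal of the joint law is the law of the rescaled spin field,
`(spinEnergyFieldLaw μ Λ δ ρ Z).fst = spinFieldLaw μ Λ δ ρ` (Mathlib `Measure.fst_map_prodMk`). [folklore] -/
theorem spinEnergyFieldLaw_fst (μ : Measure (SpinConfig (Site d))) (Λ : Finset (Site d))
    (δ ρ Z : ℝ) : (spinEnergyFieldLaw μ Λ δ ρ Z).fst = spinFieldLaw μ Λ δ ρ :=
  Measure.fst_map_prodMk (measurable_energyField μ Λ δ Z)

/-- The energy marginal of the joint law is the law of the rescaled energy field,
`(spinEnergyFieldLaw μ Λ δ ρ Z).snd = μ.map (energyField μ Λ δ Z)` (Mathlib `Measure.snd_map_prodMk`). [folklore] -/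
theorem spinEnergyFieldLaw_snd (μ : Measure (SpinConfig (Site d))) (Λ : Finset (Site d))
    (δ ρ Z : ℝ) : (spinEnergyFieldLaw μ Λ δ ρ Z).snd = μ.map (energyField μ Λ δ Z) :=
  Measure.snd_map_prodMk (measurable_spinField Λ δ ρ)

/-- **Centring under the joint law.** For a probability measure `μ` the energy coordinate has mean
zero: `∫ ω.2 h d(spinEnergyFieldLaw μ Λ δ ρ Z)(ω) = 0` for every test function `h`. [folklore] -/
theorem integral_snd_apply_spinEnergyFieldLaw (μ : Measure (SpinConfig (Site d)))
    [IsProbabilityMeasure μ] (Λ : Finset (Site d)) (δ ρ Z : ℝ)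
    (h : 𝓢(EuclideanSpace ℝ (Fin d), ℝ)) :
    ∫ ω, ω.2 h ∂(spinEnergyFieldLaw μ Λ δ ρ Z) = 0 := by
  have hm : Measurable fun ω : FieldConfig (EuclideanSpace ℝ (Fin d)) ×
      FieldConfig (EuclideanSpace ℝ (Fin d)) => ω.2 h :=
    (measurable_eval h).comp measurable_snd
  rw [spinEnergyFieldLaw, integral_map (measurable_spinEnergyField μ Λ δ ρ Z).aemeasurable
    hm.aestronglyMeasurable]
  simpa using integral_energyField_apply μ Λ δ Z h

/-! ### The Ising case: finite-volume plus measure in a box -/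

/-- The **joint law of the rescaled critical Ising spin and energy fields** at mesh `δ`: for a
dimension `d`, inverse temperature `β`, box sides `L : ℝ → ℕ`, spin renormalisation `ρ : ℝ → ℝ` and
energy renormalisation `Z : ℝ → ℝ`, the push-forward of the finite-volume plus measure
`μ⁺ = isingMeasure (zdGraph d) (box d (L δ)) β 0 .plus` under `σ ↦ (Φ_δ, E_δ)` with
`Φ_δ(f) = ρ(δ) δᵈ ∑_{x ∈ box d (L δ)} f(δx) σₓ` (`spinField`) and
`E_δ(h) = Z(δ) δᵈ ∑_{a ∈ box d (L δ)} ∑_{i : Fin d} h(δa) (σ_a σ_{a+eᵢ} − ⟨σ_a σ_{a+eᵢ}⟩⁺)`, the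
bond expectations `⟨·⟩⁺` being taken under the same measure `μ⁺` (centred energy field): a
probability measure on `FieldConfig ℝᵈ × FieldConfig ℝᵈ` whose first marginal is
`isingFieldLaw d β L δ ρ` (`isingSpinEnergyFieldLaw_fst`). Consumers take `β = criticalBeta d` and
impose `δ L(δ) → ∞` as `δ → 0⁺`. (Aizenman–Duminil-Copin 2021, (1.5), `T_{f,L}`; Hongler–Smirnov
2013, §1, energy density field with `+` boundary conditions.) [cite: AizenmanDuminilCopinAnnals2021, §1.2 eq. (1.5)] -/
def isingSpinEnergyFieldLaw (d : ℕ) (β : ℝ) (L : ℝ → ℕ) (δ : ℝ) (ρ Z : ℝ → ℝ) :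
    Measure (FieldConfig (EuclideanSpace ℝ (Fin d)) × FieldConfig (EuclideanSpace ℝ (Fin d))) :=
  spinEnergyFieldLaw (isingMeasure (zdGraph d) (box d (L δ)) β 0 .plus) (box d (L δ)) δ (ρ δ) (Z δ)

/-- Unfolding lemma: `isingSpinEnergyFieldLaw` is the push-forward of the finite-volume plus measure
along `σ ↦ (spinField (box d (L δ)) δ (ρ δ) σ, energyField μ⁺ (box d (L δ)) δ (Z δ) σ)`.
[cite: AizenmanDuminilCopinAnnals2021, §1.2 eq. (1.5)] -/
theorem isingSpinEnergyFieldLaw_eq_map (d : ℕ) (β : ℝ) (L : ℝ → ℕ) (δ : ℝ) (ρ Z : ℝ → ℝ) :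
    isingSpinEnergyFieldLaw d β L δ ρ Z =
      (isingMeasure (zdGraph d) (box d (L δ)) β 0 .plus).map (fun σ =>
        (spinField (box d (L δ)) δ (ρ δ) σ,
          energyField (isingMeasure (zdGraph d) (box d (L δ)) β 0 .plus) (box d (L δ)) δ (Z δ) σ)) :=
  rfl

/-- The energy coordinate of `isingSpinEnergyFieldLaw`, evaluated in the printed form of the request:
`E_δ(h) = Z(δ) δᵈ ∑_{a ∈ box d (L δ)} ∑_{i : Fin d} h(δa) (σ_a σ_{a+eᵢ} − ⟨σ_a σ_{a+eᵢ}⟩⁺_{box; β, 0})`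
with `⟨σ_a σ_b⟩⁺ = isingTwoPoint (zdGraph d) (box d (L δ)) β 0 .plus a b`.
(Aizenman–Duminil-Copin 2021, (1.5); Hongler–Smirnov 2013, §1.) [cite: AizenmanDuminilCopinAnnals2021, §1.2 eq. (1.5)] -/
theorem energyField_isingMeasure_apply (d : ℕ) (β : ℝ) (L : ℝ → ℕ) (δ : ℝ) (Z : ℝ → ℝ)
    (σ : SpinConfig (Site d)) (h : 𝓢(EuclideanSpace ℝ (Fin d), ℝ)) :
    energyField (isingMeasure (zdGraph d) (box d (L δ)) β 0 .plus) (box d (L δ)) δ (Z δ) σ h =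
      Z δ * δ ^ d * ∑ a ∈ box d (L δ), ∑ i : Fin d, h (δ • siteToE a) *
        (spinAt a σ * spinAt (a + Pi.single i 1) σ -
          isingTwoPoint (zdGraph d) (box d (L δ)) β 0 .plus a (a + Pi.single i 1)) :=
  energyField_apply _ _ _ _ σ h

/-- The joint Ising field law is a probability measure. [folklore] -/
instance isingSpinEnergyFieldLaw.instIsProbabilityMeasure (d : ℕ) (β : ℝ) (L : ℝ → ℕ) (δ : ℝ)
    (ρ Z : ℝ → ℝ) : IsProbabilityMeasure (isingSpinEnergyFieldLaw d β L δ ρ Z) := by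
  unfold isingSpinEnergyFieldLaw
  infer_instance

/-- **Extends `isingFieldLaw`.** The spin marginal of the joint law is the law of the rescaled spin
field of `FieldScalingLimit.lean`: `(isingSpinEnergyFieldLaw d β L δ ρ Z).fst = isingFieldLaw d β L δ ρ`.
[folklore] -/
theorem isingSpinEnergyFieldLaw_fst (d : ℕ) (β : ℝ) (L : ℝ → ℕ) (δ : ℝ) (ρ Z : ℝ → ℝ) :
    (isingSpinEnergyFieldLaw d β L δ ρ Z).fst = isingFieldLaw d β L δ ρ :=
  spinEnergyFieldLaw_fst _ _ _ _ _

/-- The energy marginal of the joint Ising law is the law of the rescaled centred energy field under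
the finite-volume plus measure. [folklore] -/
theorem isingSpinEnergyFieldLaw_snd (d : ℕ) (β : ℝ) (L : ℝ → ℕ) (δ : ℝ) (ρ Z : ℝ → ℝ) :
    (isingSpinEnergyFieldLaw d β L δ ρ Z).snd =
      (isingMeasure (zdGraph d) (box d (L δ)) β 0 .plus).map
        (energyField (isingMeasure (zdGraph d) (box d (L δ)) β 0 .plus) (box d (L δ)) δ (Z δ)) :=
  spinEnergyFieldLaw_snd _ _ _ _ _

/-- **The Ising energy field is centred**: `∫ ω.2 h d(isingSpinEnergyFieldLaw d β L δ ρ Z)(ω) = 0`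
for every test function `h`. [folklore] -/
theorem integral_snd_apply_isingSpinEnergyFieldLaw (d : ℕ) (β : ℝ) (L : ℝ → ℕ) (δ : ℝ)
    (ρ Z : ℝ → ℝ) (h : 𝓢(EuclideanSpace ℝ (Fin d), ℝ)) :
    ∫ ω, ω.2 h ∂(isingSpinEnergyFieldLaw d β L δ ρ Z) = 0 :=
  integral_snd_apply_spinEnergyFieldLaw _ _ _ _ _ h

end Literature.Probability.LatticeModels
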